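import Mathlib.Tactic.LinearCombination
import Mathlib.Tactic.Linarith
import Mathlib.Data.Int.Basic
import HarnessLib

/-!
# Crux `FrobeniusLadder.FRationalResolution` (stmt-ResolutionOfSingularities-15317), line `redirect`,
# stub `stub_diagonalizableQuotientResolution` — **the determinant identities behind the charts of
# the point blow-up of a rank-2 toric singularity** (core of claim (C3) of memo
# MEMO-15317-leafhand2-g6 §3, brick P4; integer arithmetic only)

For a saturated sharp rank-`2` monoid `P ⊆ ℤ²` with Hilbert basis `h₀, …, h_s` in angular order one
has `det(h_{i−1}, h_i) = 1` and `h_{i−1} + h_{i+1} = b_i h_i` (`b_i ≥ 2`). The blow-up of the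
closed point (`K = P⁺`) has, at the interior basis element `h_i`, the chart monoid generated by
`P` and `HB − h_i`, whose cone is spanned by `h_{i−1} − h_i` and `h_{i+1} − h_i`; its INDEX is

  `det(h_{i−1} − h_i, h_{i+1} − h_i) = b_i − 2`,

so the chart is regular for `b_i ≤ 3` and an `A_{b_i−3}` singularity for `b_i ≥ 4` (in the basis
`(h_{i−1} − h_i, h_i)` the second ray is `(−1, b_i − 2)`), while the end charts have index
`det(h₀, h₁ − h₀) = det(h₀, h₁) = 1`. This file records exactly these identities for integer
vectors written in coordinates (`u = h_{i−1}`, `v = h_i`, `w = h_{i+1}`); the monoid-level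
statements (saturation, Hilbert bases of `AddSubmonoid (Fin 2 → ℤ)`) are brick P4 proper.
Kill-tested numerically on all cones `(a,r)`, `r ≤ 13` (memo §3). [folklore; toric surfaces,
cf. Kato 1994 (10.3) charts `P⟨s − a⟩`]
-/

-- single-problem summit: the doubled namespace component is forced
set_option linter.dupNamespace false

namespace Summit.ResolutionOfSingularities.ResolutionOfSingularities.Theorems.FRationalResolution.RankTwoBlowupChartDeterminants

/-- If `det(u,v) = 1` and `u + w = b v` then `b = det(u,w)`: the Hirzebruch–Jung coefficient of a
Hilbert-basis triple is a determinant. [folklore] -/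
theorem coeff_eq_det (u₀ u₁ v₀ v₁ w₀ w₁ b : ℤ) (huv : u₀ * v₁ - u₁ * v₀ = 1)
    (hw₀ : u₀ + w₀ = b * v₀) (hw₁ : u₁ + w₁ = b * v₁) :
    b = u₀ * w₁ - u₁ * w₀ := by
  have e₀ : w₀ = b * v₀ - u₀ := by linarith
  have e₁ : w₁ = b * v₁ - u₁ := by linarith
  subst e₀ e₁
  linear_combination (-b) * huv

/-- Consecutive unimodularity propagates along a Hilbert-basis triple: `det(u,v) = 1` and
`u + w = b v` give `det(v,w) = 1`. [folklore] -/
theorem det_next_eq_one (u₀ u₁ v₀ v₁ w₀ w₁ b : ℤ) (huv : u₀ * v₁ - u₁ * v₀ = 1)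
    (hw₀ : u₀ + w₀ = b * v₀) (hw₁ : u₁ + w₁ = b * v₁) :
    v₀ * w₁ - v₁ * w₀ = 1 := by
  have e₀ : w₀ = b * v₀ - u₀ := by linarith
  have e₁ : w₁ = b * v₁ - u₁ := by linarith
  subst e₀ e₁
  linear_combination huv

/-- **Index of the interior blow-up chart.** For a Hilbert-basis triple `u, v, w` of a rank-2
cone (`det(u,v) = 1`, `u + w = b v`) the cone of the blow-up chart at `v`, spanned by `u − v` and
`w − v`, has determinant `b − 2`: regular for `b ∈ {2, 3}` (index `0` = half-plane chart `ℕ × ℤ`,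
index `1`), an `A_{b−3}` singularity for `b ≥ 4`. [folklore] -/
theorem det_interior_chart (u₀ u₁ v₀ v₁ w₀ w₁ b : ℤ) (huv : u₀ * v₁ - u₁ * v₀ = 1)
    (hw₀ : u₀ + w₀ = b * v₀) (hw₁ : u₁ + w₁ = b * v₁) :
    (u₀ - v₀) * (w₁ - v₁) - (u₁ - v₁) * (w₀ - v₀) = b - 2 := by
  have e₀ : w₀ = b * v₀ - u₀ := by linarith
  have e₁ : w₁ = b * v₁ - u₁ := by linarith
  subst e₀ e₁
  linear_combination (b - 2) * huv

/-- **Normal form of the interior chart.** In the (unimodular) basis `(u − v, v)` the second ray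
`w − v` of the interior chart has coordinates `(−1, b − 2)`, i.e. `w − v = −(u − v) + (b − 2) v`;
after the shear `(x, y) ↦ (x + y, y)` this is the cone `⟨(1,0), (b−3, b−2)⟩` of the `A_{b−3}`
singularity. [folklore] -/
theorem interior_chart_second_ray (u₀ u₁ v₀ v₁ w₀ w₁ b : ℤ)
    (hw₀ : u₀ + w₀ = b * v₀) (hw₁ : u₁ + w₁ = b * v₁) :
    w₀ - v₀ = -(u₀ - v₀) + (b - 2) * v₀ ∧ w₁ - v₁ = -(u₁ - v₁) + (b - 2) * v₁ := by
  constructor <;> linarith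

/-- The basis `(u − v, v)` used above is unimodular when `det(u,v) = 1`. [folklore] -/
theorem det_sub_self_basis (u₀ u₁ v₀ v₁ : ℤ) (huv : u₀ * v₁ - u₁ * v₀ = 1) :
    (u₀ - v₀) * v₁ - (u₁ - v₁) * v₀ = 1 := by
  linear_combination huv

/-- **Index of the end blow-up charts.** At an extreme Hilbert-basis element `u` (neighbour `v`,
`det(u,v) = 1`) the chart cone is spanned by `u` and `v − u` and is unimodular: the end charts of
the point blow-up are regular. [folklore] -/
theorem det_end_chart (u₀ u₁ v₀ v₁ : ℤ) (huv : u₀ * v₁ - u₁ * v₀ = 1) :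
    u₀ * (v₁ - u₁) - u₁ * (v₀ - u₀) = 1 := by
  linear_combination huv

/-- **The measure drops by two.** For the `A_m` cone in Hilbert-basis form — a triple `u, v, w`
with `u + w = (m+1) v` — the interior chart has index `(m + 1) − 2 = m − 1`, the index of
`A_{m−2}`; in general the new coefficient `b' = b − 2` satisfies `b' + 2 ≤ b`. (Arithmetic shadow
of claim (C4): one point blow-up turns `A_m` into `A_{m−2}`.) [folklore] -/
theorem det_interior_chart_A (u₀ u₁ v₀ v₁ w₀ w₁ : ℤ) (m : ℕ) (huv : u₀ * v₁ - u₁ * v₀ = 1)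
    (hw₀ : u₀ + w₀ = ((m : ℤ) + 1) * v₀) (hw₁ : u₁ + w₁ = ((m : ℤ) + 1) * v₁) :
    (u₀ - v₀) * (w₁ - v₁) - (u₁ - v₁) * (w₀ - v₀) = (m : ℤ) - 1 := by
  have h := det_interior_chart u₀ u₁ v₀ v₁ w₀ w₁ ((m : ℤ) + 1) huv hw₀ hw₁
  linarith

end Summit.ResolutionOfSingularities.ResolutionOfSingularities.Theorems.FRationalResolution.RankTwoBlowupChartDeterminants
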